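import Mathlib.LinearAlgebra.Matrix.Charpoly.Univ
import Mathlib.LinearAlgebra.Matrix.NonsingularInverse
import Mathlib.Topology.Algebra.MvPolynomial
import Mathlib.Topology.Instances.Matrix
import Mathlib.FieldTheory.Separable
import Literature.LinearAlgebra.Matrix.CentraliserOfSeparableCharpoly
import Literature.LinearAlgebra.Matrix.RegularSemisimpleConjClassClosed
import HarnessLib

/-!
# Local rigidity of the characteristic polynomial on a torus: near a regular semisimple `γ`, two COMMUTING matrices with the same
# characteristic polynomial are EQUAL (Weyl separation for orbital integrals)

Topic `LinearAlgebra/Matrix`; namespace `Literature.LinearAlgebra.Matrix`. THEOREMS ONLY over Mathlib + ★ `CentraliserOfSeparableCharpoly` + ★ `RegularSemisimpleConjClassClosed`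
(no definition, no instance, no notation, no named fact, no `sorry`). Cell `pub/hodgecm-mathlib`, road «N6-ns», brick N6ns-reg-(ii) (LEAD T8-2 (3)):
the ONE group-theoretic input («(w-sep)» of the census) of the unitary dress of ★ `OrbitalIntegralLocallyConstantChart` — it discharges the
chart-saturation hypothesis `x t x⁻¹ ∈ Ω ⇒ x ∈ S·T` from the injectivity of the chart.

THE MATHEMATICS (Hensel-type uniqueness, no eigenvalues, no algebraic closure, no norm). For a polynomial `f = Σ a_k X^k` and elements `x, y` of a
ring put `D_N(f; x, y) := Σ_{k<N} a_k • Σ_{j<k} y^j x^{k−1−j}` (the divided difference). If `x` and `y` COMMUTE then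
`f(y) − f(x) = D_N(f; x, y) · (y − x)` (`natDegree f < N`; Mathlib `Commute.geom_sum₂_mul`), and `D_N(f; x, x) = f′(x)`. For `f = χ_x` the
characteristic polynomial of a matrix `x` the map `(x, y) ↦ D(χ_x; x, y)` is CONTINUOUS (the coefficients of `χ_x` are polynomials in the entries of
`x`: ★ `continuous_charpoly_coeff`, `RegularSemisimpleConjClassClosed`), and at `(γ, γ)` with `χ_γ` SEPARABLE its
value `χ_γ′(γ)` is a UNIT (`a χ_γ + b χ_γ′ = 1` and Cayley–Hamilton). Units of `M_n` are the locus `det ≠ 0`, open; hence for `(x, y)` near `(γ, γ)`,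
`D(χ_x; x, y)` is a unit, and if moreover `x, y` commute and `χ_y = χ_x` then `0 = χ_x(y) − χ_x(x) = D · (y − x)` (Cayley–Hamilton twice) forces
`y = x`:
* `eventually_eq_of_commute_of_charpoly_eq` — `∀ᶠ (x, y) → (γ, γ)`, `Commute x y → χ_y = χ_x → x = y`.
* `eventually_mem_centralizer_of_conj_eq` (THE WEYL SEPARATION, `GL_n` form): for `γ ∈ GL_n(E)` regular semisimple, for `(t, t′)` near `(γ, γ)` in
  `Z(γ) × Z(γ)`: `y t y⁻¹ = t′ ⇒ y ∈ Z(t)` — `t, t′` commute (★ `commute_of_commute_of_charpoly_separable`: the centraliser of `γ` is abelian) and are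
  conjugate, hence equal; so no non-trivial «Weyl conjugate» of `t` near `γ` is again near `γ`.

## References
* [HarishChandra1970] Harish-Chandra (notes by G. van Dijk), *Harmonic Analysis on Reductive p-adic Groups*, LNM 162 (1970), Part I §3 (regular
  elements, the map `G/A × A′ → G`).
* [Rogawski1990] J. D. Rogawski, *Automorphic Representations of Unitary Groups in Three Variables*, Ann. of Math. Stud. 123 (1990), §3.1 p. 19.
* [Borel1991] A. Borel, *Linear Algebraic Groups*, 2nd ed. (1991), IV.12.2–12.3 (regular semisimple elements).
-/

set_option autoImplicit false

open Polynomial Filter Topology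
open scoped Matrix

namespace Literature.LinearAlgebra.Matrix

/-! ## §1 The divided difference of a polynomial at two commuting points -/

section DividedDifference

variable {R : Type*} [CommRing R] {A : Type*} [Ring A] [Algebra R A]

/-- **`f(y) − f(x) = D_N(f; x, y) · (y − x)` for COMMUTING `x, y`** (`natDegree f < N`), with the divided difference
`D_N(f; x, y) = Σ_{k<N} a_k • Σ_{j<k} y^j x^{k−1−j}` (Mathlib `Commute.geom_sum₂_mul` per monomial). [cite: Borel1991, IV.12.2] -/
theorem aeval_sub_aeval_eq_dividedDiff_mul (f : R[X]) {N : ℕ} (hN : f.natDegree < N) {x y : A} (h : Commute x y) :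
    aeval y f - aeval x f =
      (∑ k ∈ Finset.range N, f.coeff k • ∑ j ∈ Finset.range k, y ^ j * x ^ (k - 1 - j)) * (y - x) := by
  rw [aeval_eq_sum_range' hN, aeval_eq_sum_range' hN, ← Finset.sum_sub_distrib, Finset.sum_mul]
  refine Finset.sum_congr rfl fun k _ => ?_
  rw [smul_mul_assoc, h.symm.geom_sum₂_mul k, smul_sub]

/-- **`D_N(f; x, x) = f′(x)`**. [cite: Borel1991, IV.12.2] -/
theorem dividedDiff_self (f : R[X]) {N : ℕ} (hN : f.natDegree < N) (x : A) :
    (∑ k ∈ Finset.range N, f.coeff k • ∑ j ∈ Finset.range k, x ^ j * x ^ (k - 1 - j)) = aeval x (derivative f) := by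
  have hinner : ∀ k : ℕ, (∑ j ∈ Finset.range k, x ^ j * x ^ (k - 1 - j)) = (k : R) • x ^ (k - 1) := fun k => by
    have hterm : ∀ j ∈ Finset.range k, x ^ j * x ^ (k - 1 - j) = x ^ (k - 1) := fun j hj => by
      rw [← pow_add]
      congr 1
      have := Finset.mem_range.1 hj
      omega
    rw [Finset.sum_congr rfl hterm, Finset.sum_const, Finset.card_range, Nat.cast_smul_eq_nsmul]
  simp_rw [hinner, smul_smul]
  rw [derivative_apply, Polynomial.sum_over_range' f (fun k => by rw [zero_mul, map_zero, zero_mul]) N hN, map_sum]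
  refine Finset.sum_congr rfl fun k _ => ?_
  rw [map_mul, map_pow, aeval_C, aeval_X, ← Algebra.smul_def]

/-- **`f′(x)` is a unit when `f` is separable and `f(x) = 0`** (`a f + b f′ = 1` evaluated at `x`). [cite: Borel1991, IV.12.3] -/
theorem isUnit_aeval_derivative_of_separable {f : R[X]} (hsep : f.Separable) {x : A} (hx : aeval x f = 0) :
    IsUnit (aeval x (derivative f)) := by
  obtain ⟨a, b, hab⟩ := hsep
  have h1 : aeval x b * aeval x (derivative f) = 1 := by
    have h := congrArg (aeval x) hab
    rwa [map_add, map_mul, map_mul, hx, mul_zero, zero_add, map_one] at h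
  have h2 : aeval x (derivative f) * aeval x b = 1 := by
    rw [← map_mul, mul_comm, map_mul, h1]
  exact ⟨⟨aeval x (derivative f), aeval x b, h2, h1⟩, rfl⟩

end DividedDifference

/-! ## §2 Matrices: local rigidity (continuity of the coefficients of `χ_x`: ★ `continuous_charpoly_coeff`) -/

section Matrices

variable {E : Type*} [Field E] [TopologicalSpace E] [IsTopologicalRing E]
  {n : Type*} [Fintype n] [DecidableEq n]

variable [T1Space E]

/-- **LOCAL RIGIDITY OF THE CHARACTERISTIC POLYNOMIAL NEAR A REGULAR SEMISIMPLE MATRIX**: if `χ_γ` is separable then for `(x, y)` near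
`(γ, γ)`, `x y = y x` and `χ_y = χ_x` imply `x = y` (divided difference `D(χ_x; x, y)` is a unit near `(γ, γ)` since `D(χ_γ; γ, γ) = χ_γ′(γ)` is
one; `0 = χ_x(y) − χ_x(x) = D · (y − x)` by Cayley–Hamilton twice). [cite: HarishChandra1970, Part I §3] [cite: Borel1991, IV.12.3] -/
theorem eventually_eq_of_commute_of_charpoly_eq (γ : Matrix n n E) (hγ : γ.charpoly.Separable) :
    ∀ᶠ p : Matrix n n E × Matrix n n E in 𝓝 (γ, γ), Commute p.1 p.2 → p.2.charpoly = p.1.charpoly → p.1 = p.2 := by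
  haveI : Nontrivial E := inferInstance
  -- the divided difference `Δ p = D(χ_{p.1}; p.1, p.2)` with `N = card n + 1`
  have hcont : Continuous fun p : Matrix n n E × Matrix n n E =>
      ∑ k ∈ Finset.range (Fintype.card n + 1), p.1.charpoly.coeff k • ∑ j ∈ Finset.range k, p.2 ^ j * p.1 ^ (k - 1 - j) := by
    refine continuous_finsetSum _ fun k _ => ?_
    refine ((continuous_charpoly_coeff k).comp continuous_fst).smul ?_
    exact continuous_finsetSum _ fun j _ => (continuous_snd.pow j).mul (continuous_fst.pow _)
  have hdet : Continuous fun p : Matrix n n E × Matrix n n E =>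
      (∑ k ∈ Finset.range (Fintype.card n + 1), p.1.charpoly.coeff k • ∑ j ∈ Finset.range k, p.2 ^ j * p.1 ^ (k - 1 - j)).det :=
    hcont.matrix_det
  have hN : ∀ x : Matrix n n E, x.charpoly.natDegree < Fintype.card n + 1 := fun x => by
    rw [Matrix.charpoly_natDegree_eq_dim]
    exact Nat.lt_succ_self _
  -- at `(γ, γ)` the divided difference is `χ_γ′(γ)`, a unit
  have hγu : (∑ k ∈ Finset.range (Fintype.card n + 1), γ.charpoly.coeff k • ∑ j ∈ Finset.range k, γ ^ j * γ ^ (k - 1 - j)).det ≠ 0 := by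
    rw [dividedDiff_self γ.charpoly (hN γ) γ]
    exact ((Matrix.isUnit_iff_isUnit_det _).1 (isUnit_aeval_derivative_of_separable hγ (Matrix.aeval_self_charpoly γ))).ne_zero
  have hev := (hdet.tendsto (γ, γ)).eventually_ne hγu
  filter_upwards [hev] with p hp hcomm hchar
  have hD : IsUnit (∑ k ∈ Finset.range (Fintype.card n + 1),
      p.1.charpoly.coeff k • ∑ j ∈ Finset.range k, p.2 ^ j * p.1 ^ (k - 1 - j)) :=
    (Matrix.isUnit_iff_isUnit_det _).2 (isUnit_iff_ne_zero.2 hp)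
  have key := aeval_sub_aeval_eq_dividedDiff_mul p.1.charpoly (hN p.1) hcomm
  have h2 : aeval p.2 p.1.charpoly = 0 := by
    rw [← hchar]
    exact Matrix.aeval_self_charpoly p.2
  rw [h2, Matrix.aeval_self_charpoly, sub_zero, eq_comm, hD.mul_right_eq_zero, sub_eq_zero] at key
  exact key.symm

/-- **WEYL SEPARATION NEAR A REGULAR SEMISIMPLE ELEMENT (`GL_n` form)**: for `γ ∈ GL_n(E)` with separable characteristic polynomial and `(t, t′)`
near `(γ, γ)` with `t, t′ ∈ Z(γ)`: if `y t y⁻¹ = t′` for some `y ∈ GL_n(E)` then `y ∈ Z(t)` (indeed `t′ = t`: both lie in the ABELIAN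
centraliser of `γ` ★ `commute_of_commute_of_charpoly_separable`, so they commute, and they are conjugate, so `χ_{t′} = χ_t`; local rigidity).
Consumed by the chart-local orbital integrals (★ `OrbitalIntegralLocallyConstantChart`, hypothesis (SAT)). [cite: HarishChandra1970, Part I §3]
[cite: Rogawski1990, §3.1 p. 19] -/
theorem eventually_mem_centralizer_of_conj_eq (γ : GL n E) (hγ : (γ : Matrix n n E).charpoly.Separable) :
    ∀ᶠ p : GL n E × GL n E in 𝓝 (γ, γ),
      p.1 ∈ Subgroup.centralizer ({γ} : Set (GL n E)) → p.2 ∈ Subgroup.centralizer ({γ} : Set (GL n E)) →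
        ∀ y : GL n E, y * p.1 * y⁻¹ = p.2 → p.2 = p.1 ∧ y ∈ Subgroup.centralizer ({p.1} : Set (GL n E)) := by
  have hval : Tendsto (fun p : GL n E × GL n E => ((p.1 : Matrix n n E), (p.2 : Matrix n n E))) (𝓝 (γ, γ))
      (𝓝 ((γ : Matrix n n E), (γ : Matrix n n E))) :=
    ((Units.continuous_val.comp continuous_fst).prodMk (Units.continuous_val.comp continuous_snd)).tendsto (γ, γ)
  filter_upwards [hval.eventually (eventually_eq_of_commute_of_charpoly_eq (γ : Matrix n n E) hγ)] with p hp ht ht' y hy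
  have hct : Commute (p.1 : Matrix n n E) (γ : Matrix n n E) := by
    have h := congrArg (fun g : GL n E => (g : Matrix n n E)) (Subgroup.mem_centralizer_singleton_iff.1 ht)
    simp only [Units.val_mul] at h
    exact h
  have hct' : Commute (p.2 : Matrix n n E) (γ : Matrix n n E) := by
    have h := congrArg (fun g : GL n E => (g : Matrix n n E)) (Subgroup.mem_centralizer_singleton_iff.1 ht')
    simp only [Units.val_mul] at h
    exact h
  have hcomm : Commute (p.1 : Matrix n n E) (p.2 : Matrix n n E) := commute_of_commute_of_charpoly_separable hγ hct hct'
  have hchar : (p.2 : Matrix n n E).charpoly = (p.1 : Matrix n n E).charpoly := by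
    rw [← hy, Units.val_mul, Units.val_mul, Matrix.coe_units_inv, Matrix.charpoly_units_conj]
  have heq : p.1 = p.2 := Units.ext (hp hcomm hchar)
  refine ⟨heq.symm, ?_⟩
  rw [Subgroup.mem_centralizer_singleton_iff]
  rw [← heq] at hy
  have h := congrArg (fun g => g * y) hy
  simpa only [inv_mul_cancel_right] using h

end Matrices

end Literature.LinearAlgebra.Matrix
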